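import Summits.QuantumFields.YangMills.Theorems.FluctuationComparisonRegPrIntLS2BetaQuaternionReadOneStepDictionary
import Summits.QuantumFields.YangMills.Theorems.FluctuationComparisonRegPrIntLS2BetaQuaternionReadTowerTelescope
import Summits.QuantumFields.YangMills.Theorems.FluctuationComparisonRegPrIntLS2BetaChartReadSecondOrder
import HarnessLib

/-!
# S2β · Q9b — THE ONE-STEP BRACKET AT THE T³ ORGAN, PRICED AND RADIUS-FREE: `‖η_coarse(b) − DMq^{one}(V) η_fine (b)‖ ≤ 4551000·ℓ²·(max_{blocks(σ₁b)} ‖ζ̃‖)²`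

Cell `ym3-torus` (rung R3 = continuum `SU(2)` YM₃ on T³ at fixed lattice data — NOT d = 4, NOT infinite volume, NOT a mass gap, NOT Clay).  Width seat `ym3-torus-px5` (gen 23);
crux `stmt-QuantumFields-20520`, LINE g18-1 S2β, AVG₂♭-ax_q ∕ `hLoc` road: Q7 ✓p827759 (telescope of one-step brackets), Q8 ✓p828063, Q9a `…QuaternionReadOneStepDictionary`
(gap-one dictionary), and px13 g26's (β) bricks (β-2) ✓p828117, (β-3) ✓p828183 ([Balaban1985Averaging] Prop. 3 (123) for the tree's one-step chart read, incl. the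
RADIUS-FREE editions `norm_chartRead_sub_fderiv_le_global_SU2` ∕ `_local_SU2` and the Cauchy sup bound `norm_coe_fderiv_chartRead_le`).  THIS FILE closes the one-step layer
at the organ: every bracket of Q7's telescope is `≤ C·ℓ²·(local sup of the fine exact chords)²`, with NO smallness hypothesis on the chords — the counts (5a) px20 g23 ∕ (5b)
px16 g22 ✓p828102 take it from here.  `--kind proof --supports stmt-QuantumFields-20520 --as helper`, count-neutral, DEFINITION-FREE (0 `def`, 0 `instance`, 0 `notation`,
0 `sorry`, default heartbeats).

NOTATION (as in Q9a; `ℓ := ((d+2)·L : ℕ)` of `F.P (i+1)`, `= 5L`).  Q1's guard at `(i, i+1)`: `0 ≤ θ`, `(5L)²∕4·θ_{i+1} ≤ α ≤ 1∕24`, `α < δ_{SU(2)}`, `157α < L⁻²`,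
`V ∈ histGood F ℰp θ (i+1) i` (⇒ loop guard `α ≤ 1∕12` at every coarse bond, ✓`loopGuard_of_histGood`).

WHAT IS PROVED (sorry-free).
* §1 `norm_imVec_su2Quat_le_one`, `coord_injective'` (pointwise), `third_le_innerRadius_SU2`, the scalar lemmas `window_arith` ∕ `far_arith`.
* §2 ★★★`norm_qRead_one_sub_qfderiv_sinc_le_sq` — GLOBAL, RADIUS-FREE: for EVERY `ζ`, **`‖Mq^{one}(V) ζ b − DMq^{one}(V)(sinc∘ζ•ζ) b‖ ≤ 4551000·ℓ²·‖ζ‖_∞²`**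
  (window case: Q9a split + (β-3) `…global_SU2` + (β-2) doors `norm_coe_relAvg_sub_one_le` ∕ `norm_coe_chartRead_le` + `norm_coe_fderiv_chartRead_le` on the cubic field;
  far case `100ℓ(e^{‖ζ‖} − 1) > 1∕3`: `‖Mq‖ ≤ 1`, `‖DMq η‖ ≤ 216ℓ‖η‖`, and `ℓ‖ζ‖ > 1∕600`).
* §3 `qRead_one_sub_qfderiv_sinc_local` (the left side only reads `ζ` on `blocks(σ₁ b)`: lit ✓`avgFun_local`, ✓`fderiv_chartRead_apply_local` through Q9a's derivative dictionary and
  injectivity of `coord`); ★★★`norm_qRead_one_sub_qfderiv_sinc_le_sq_local` — **`… ≤ 4551000·ℓ²·‖ζ^{(σ₁ b)}‖_∞²`**, `ζ^{(c)} ℓ′ := if blockOf ℓ′.src ∈ {c.src, c.tgt} then ζ ℓ′ else 0`.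
* §4 ★★★`norm_oneStepBracket_le` — THE BRACKET OF Q7 FOR ANY PARTNER `W` (`ζ̃ := logVec∘su2Quat(W·V⁻¹)` bondwise; Q7 ✓`qRead_apply_logVec_chord`, px17 ✓`chordField_eq_sinc_smul_logChord`):
  **`‖imVec (su2Quat (D_{i,i+1}W b·D_{i,i+1}V b⁻¹)) − DMq^{one}(V)(ℓ ↦ imVec (su2Quat (W ℓ·V ℓ⁻¹))) b‖ ≤ 4551000·ℓ²·‖ζ̃^{(σ₁ b)}‖_∞²`**.

HONEST SCOPE.  Assembly of landed one-step bricks at the organ; the analytic input is px13 g26's (β-3) ((123) by print's Cauchy road) — nothing further of Bałaban's is asserted;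
the COUNTS over `b` and over the levels `t` (§89.4's two purses), hence `hLoc` ∕ TAYLOR♭_q ∕ AVG₂♭-ax_q, «MULT♭-ax», «CRIT-ax», (D-ax)∕(F-ax), GAP♯∘ (`stub_uniformFibreGapOrbit`, registry
3732b7df UNTOUCHED), S2β, the five registered stubs, 20520, 19936, 19200, `YM3TorusSU2` are NOT proved; no summit statement is proved by a helper; rung R3 — NOT d = 4, NOT infinite
volume, NOT a mass gap, NOT Clay; the Yang–Mills mass gap is NOT proved.

References: T. Bałaban, CMP **98** (1985) 17–51 [Balaban1985Averaging] (Prop. 3 (121)–(126) p.36, p.19 locality); CMP **109** (1987) 249–301 [Balaban1987RG1] ((0.4), (0.11) p.253);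
CMP **102** (1985) 255–275 [Balaban1985UV3] ((7) p.257, p.260).
-/

set_option autoImplicit false

noncomputable section

open scoped Matrix.Norms.L2Operator Topology RealInnerProductSpace Quaternion
open Filter Set Function
open Literature.MathematicalPhysics.QuantumLattice (su2Quat fundamentalRep fundamentalRep_apply norm_su2Quat)
open Literature.MathematicalPhysics.QuantumFieldTheory.Balaban1983to89
open Literature.MathematicalPhysics.QuantumFieldTheory.Balaban1983to89.HaarExponentialChart
open Literature.MathematicalPhysics.QuantumFieldTheory.Balaban1983to89.HaarExponentialChart.IsChartRep
open Literature.MathematicalPhysics.QuantumFieldTheory.Balaban1983to89.BlockAveraging (Small Idx avgFun loopHol blockAvg blockAvg_avg avgFun_local)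
open Literature.MathematicalPhysics.QuantumFieldTheory.Balaban1983to89.ExpMeanLog (expMeanLogSU deltaSU deltaSU_pos)
open Literature.MathematicalPhysics.QuantumFieldTheory.Balaban1983to89.Node00
open Literature.MathematicalPhysics.QuantumFieldTheory.Balaban1983to89.T3ContinuumYM3Torus
open Literature.MathematicalPhysics.QuantumFieldTheory.Balaban1983to89.T3UnitLawDensityEML (ℰp)
open Literature.MathematicalPhysics.QuantumFieldTheory.Balaban1983to89.T3UnitScaleTilt
open Literature.MathematicalPhysics.QuantumFieldTheory.Balaban1983to89.T3TiltDescent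
open Literature.MathematicalPhysics.QuantumFieldTheory.Balaban1983to89.T3LevelShift (fieldShift bondShift fieldShift_apply bondShift_bondShift)
open Literature.MathematicalPhysics.QuantumFieldTheory.Balaban1983to89.T4HaarSU2ExpChart (expPoint expPoint_zero imQuat su2Quat_expPoint)
open Literature.MathematicalPhysics.QuantumFieldTheory.Balaban1983to89.T4ExpWindowSmallField (imVec logVec norm_imVec_sq_of_norm_eq_one)
open Literature.MathematicalPhysics.QuantumFieldTheory.Balaban1983to89.B10Eq18SigmaSU2 (su2Coord su2Coord_injective)
open Literature.MathematicalPhysics.QuantumFieldTheory.Balaban1983to89.B10Eq18SigmaSU2Haar (rev)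
open Literature.MathematicalPhysics.QuantumFieldTheory.Balaban1983to89.T4Continuum
open Summit.QuantumFields.YangMills.Theorems.FluctuationComparisonRegPrIntLS2BetaChartReadDescentOntoExpPoint
  (su2Coord_rev_mem_lie expPoint_eq_expChart piExpPoint_translate_eq)
open Summit.QuantumFields.YangMills.Theorems.FluctuationComparisonRegPrIntLS2BetaChartReadDescentOntoT3 (loopGuard_of_histGood)
open Summit.QuantumFields.YangMills.Theorems.FluctuationComparisonRegPrIntLS2BetaChartReadDescentDerivKStepSupT3 (norm_coord_eq norm_coordField_eq)
open Summit.QuantumFields.YangMills.Theorems.FluctuationComparisonRegPrIntLS2BetaChartReadDerivLocal (fderiv_chartRead_apply_local)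
open Summit.QuantumFields.YangMills.Theorems.FluctuationComparisonRegPrIntLS2BetaChartReadCplxAnalytic (norm_coe_relAvg_sub_one_le norm_coe_chartRead_le)
open Summit.QuantumFields.YangMills.Theorems.FluctuationComparisonRegPrIntLS2BetaChartReadSecondOrder
  (norm_chartRead_sub_fderiv_le_global_SU2 norm_coe_fderiv_chartRead_le)
open Summit.QuantumFields.YangMills.Theorems.FluctuationComparisonRegPrIntLS2BetaQuaternionReadFibreIdentity (norm_sinc_smul_sub_self_le chordField_eq_sinc_smul_logChord)
open Summit.QuantumFields.YangMills.Theorems.FluctuationComparisonRegPrIntLS2BetaQuaternionReadRemainderDictionary (coord_smul norm_sinc_sub_one_smul_coord_le)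
open Summit.QuantumFields.YangMills.Theorems.FluctuationComparisonRegPrIntLS2BetaQuaternionReadTowerTelescope (qRead_apply_logVec_chord)
open Summit.QuantumFields.YangMills.Theorems.FluctuationComparisonRegPrIntLS2BetaQuaternionReadOneStepDictionary

namespace Summit.QuantumFields.YangMills.Theorems.FluctuationComparisonRegPrIntLS2BetaQuaternionReadOneStepBracket

variable {F : T3Family}

/-! ## §1 Pointwise helpers -/

section Pointwise

/-- `‖imVec (su2Quat g)‖ ≤ 1`: the imaginary part of a unit quaternion. [folklore] -/
theorem norm_imVec_su2Quat_le_one (g : SU 2) : ‖imVec (su2Quat g)‖ ≤ 1 := by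
  have h := norm_imVec_sq_of_norm_eq_one (norm_su2Quat g)
  nlinarith [sq_nonneg (su2Quat g).re, norm_nonneg (imVec (su2Quat g))]

/-- `coord` is injective: `coord x = coord y → x = y` (`su2Coord` injective, `rev` an isometry). [cite: Balaban1985UV3, p. 260 (bookkeeping)] -/
theorem coord_injective' {x y : EuclideanSpace ℝ (Fin 3)}
    (h : (⟨su2Coord (rev x), su2Coord_rev_mem_lie x⟩ : (specialUnitaryLogChart (Fin 2)).lie) = ⟨su2Coord (rev y), su2Coord_rev_mem_lie y⟩) : x = y := by
  have h1 : su2Coord (WithLp.ofLp (rev x)) = su2Coord (WithLp.ofLp (rev y)) := congrArg Subtype.val h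
  have h2 : WithLp.ofLp (rev x) = WithLp.ofLp (rev y) := su2Coord_injective h1
  have h3 : rev x = rev y := WithLp.ofLp_injective 2 h2
  exact rev.injective h3

/-- The inner radius of the `SU(2)` log chart is at least `1∕3`. [cite: Helgason2000, Ch. I §1 Thm. 1.14 (13) p. 96 (bookkeeping)] -/
theorem third_le_innerRadius_SU2 : (1 / 3 : ℝ) ≤ innerRadius (specialUnitaryLogChart (Fin 2)) := by
  unfold innerRadius; rw [specialUnitaryLogChart_ρ, Fintype.card_fin]; norm_num

/-- The scalar bookkeeping of the window case: `100ℓ(e^m − 1) ≤ 1∕3`, `e^m − 1 ≤ 2m`, `A ≤ 4550400ℓ²m²`, `0 ≤ Y ≤ 54ℓ(e^m − 1)`, `T ≤ 216ℓ·w`, `w ≤ m²∕1800`, `1 ≤ ℓ`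
give `A + Y³∕6 + T ≤ 4551000·ℓ²·m²`. [folklore] -/
theorem window_arith {ℓ m A Y T w : ℝ} (hℓ : 1 ≤ ℓ) (hcase : 100 * (ℓ * (Real.exp m - 1)) ≤ 1 / 3) (hem2 : Real.exp m - 1 ≤ 2 * m)
    (hA : A ≤ 4550400 * ℓ ^ 2 * m ^ 2) (hY0 : 0 ≤ Y) (hY : Y ≤ 54 * (ℓ * (Real.exp m - 1)))
    (hT : T ≤ 216 * ℓ * w) (hw : w ≤ m ^ 2 / 1800) :
    A + Y ^ 3 / 6 + T ≤ 4551000 * ℓ ^ 2 * m ^ 2 := by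
  have hℓ0 : 0 ≤ ℓ := by linarith
  have hY1 : Y ≤ 108 * ℓ * m := by
    have : ℓ * (Real.exp m - 1) ≤ ℓ * (2 * m) := mul_le_mul_of_nonneg_left hem2 hℓ0
    linarith
  have hY2 : Y ≤ 18 / 100 := by linarith
  have hY3 : Y ^ 3 / 6 ≤ 350 * ℓ ^ 2 * m ^ 2 := by
    have h1 : Y ^ 3 = Y * Y ^ 2 := by ring
    have h2 : Y ^ 2 ≤ (108 * ℓ * m) ^ 2 := pow_le_pow_left₀ hY0 hY1 2
    have h3 : Y * Y ^ 2 ≤ (18 / 100) * (108 * ℓ * m) ^ 2 := mul_le_mul hY2 h2 (sq_nonneg _) (by norm_num)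
    rw [h1]; nlinarith
  have hT2 : T ≤ ℓ ^ 2 * m ^ 2 := by
    have h1 : 216 * ℓ * w ≤ 216 * ℓ * (m ^ 2 / 1800) := mul_le_mul_of_nonneg_left hw (by positivity)
    have h2 : 216 * ℓ * (m ^ 2 / 1800) ≤ ℓ ^ 2 * m ^ 2 := by nlinarith [sq_nonneg m, mul_nonneg hℓ0 (sq_nonneg m)]
    linarith
  have hpos : 0 ≤ ℓ ^ 2 * m ^ 2 := by positivity
  linarith

/-- The scalar bookkeeping of the far case: `100ℓ(e^m − 1) > 1∕3`, `1 ≤ ℓ`, `0 ≤ m` give `1 + 216ℓm ≤ 4551000·ℓ²·m²` (via `ℓm > 1∕600`). [folklore] -/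
theorem far_arith {ℓ m : ℝ} (hℓ : 1 ≤ ℓ) (hm0 : 0 ≤ m) (hcase : 1 / 3 < 100 * (ℓ * (Real.exp m - 1))) :
    1 + 216 * ℓ * m ≤ 4551000 * ℓ ^ 2 * m ^ 2 := by
  have hℓm : 1 / 600 < ℓ * m := by
    by_cases hm1 : m ≤ 1
    · -- `e^m − 1 ≤ 2m` on `[0,1]` (Mathlib `Real.abs_exp_sub_one_sub_id_le`; inlined, a public copy exists elsewhere in the tree)
      have h3 := Real.abs_exp_sub_one_sub_id_le (x := m) (by rw [abs_of_nonneg hm0]; exact hm1)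
      have h4 : Real.exp m - 1 - m ≤ m ^ 2 := (le_abs_self _).trans h3
      have hem2 : Real.exp m - 1 ≤ 2 * m := by nlinarith
      nlinarith
    · rw [not_le] at hm1; nlinarith
  nlinarith [hℓm, sq_nonneg (ℓ * m)]

end Pointwise

/-! ## §2 The global radius-free bracket bound -/

section Global

set_option maxHeartbeats 400000 in
/-- ★★★ **THE ONE-STEP BRACKET, PRICED, RADIUS-FREE (global sup)**: under Q1's guard at `(i, i+1)`, for EVERY `ζ` and every coarse bond `b`,
`‖Mq^{one}(V) ζ b − DMq^{one}(V)(sinc∘ζ•ζ) b‖ ≤ 4551000·ℓ²·‖ζ‖_∞²` (`ℓ = (d+2)L = 5L`).  Window case (`100ℓ(e^{‖ζ‖} − 1) ≤ 1∕3`): Q9a's split, (β-3) ✓`norm_chartRead_sub_fderiv_le_global_SU2`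
(`4550400·ℓ²`), `‖y₁‖ ≤ 54ℓ(e^{‖ζ‖} − 1)` (β-2), `‖Dψ(0)W‖ ≤ 216ℓ‖W‖` with `‖W‖ ≤ ‖ζ‖³∕6`; far case: `‖Mq‖ ≤ 1`, `‖DMq η‖ ≤ 216ℓ‖ζ‖`, `ℓ‖ζ‖ > 1∕600`.
[cite: Balaban1985Averaging, Prop. 3 (123) p.36; Balaban1987RG1, (0.4), (0.11) p.253; Balaban1985UV3, (7) p.257, p.260] -/
theorem norm_qRead_one_sub_qfderiv_sinc_le_sq (i : ℕ) {θ : ℕ → ℝ} (hθ0 : ∀ i', 0 ≤ θ i') {α : ℝ}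
    (hθα : ∀ i', i < i' → i' ≤ i + 1 → (((5 * F.L : ℕ) : ℝ) ^ 2 / 4) * θ i' ≤ α)
    (hα24 : α ≤ 1 / 24) (hαδ : α < deltaSU (Fin 2)) (hαL : 157 * α < ((F.L : ℝ) ^ 2)⁻¹)
    {V : GaugeField (F.P (i + 1)) 0 (SU 2)} (hVg : V ∈ histGood F ℰp θ (i + 1) i)
    (ζ : PBond (F.P (i + 1)) 0 → EuclideanSpace ℝ (Fin 3)) (b : PBond (F.P i) 0) :
    ‖imVec (su2Quat (descendTo F ℰp i (i + 1) (Nat.le_succ i) (fun ℓ => expPoint (ζ ℓ) * V ℓ) b *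
          (descendTo F ℰp i (i + 1) (Nat.le_succ i) V b)⁻¹)) -
        fderiv ℝ (fun (ζ : PBond (F.P (i + 1)) 0 → EuclideanSpace ℝ (Fin 3)) (B : PBond (F.P i) 0) =>
          imVec (su2Quat (descendTo F ℰp i (i + 1) (Nat.le_succ i) (fun ℓ => expPoint (ζ ℓ) * V ℓ) B *
            (descendTo F ℰp i (i + 1) (Nat.le_succ i) V B)⁻¹))) 0 (fun ℓ => Real.sinc ‖ζ ℓ‖ • ζ ℓ) b‖ ≤
      4551000 * ((((F.P (i + 1)).d + 2) * (F.P (i + 1)).L : ℕ) : ℝ) ^ 2 * ‖ζ‖ ^ 2 := by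
  have hρ := third_le_innerRadius_SU2
  have hguard : ∀ (c : PBond (F.P (i + 1)) (0 + 1)) (idx : Idx (F.P (i + 1))), dist1 (loopHol V c idx) ≤ α :=
    fun c idx => loopGuard_of_histGood (F := F) hθ0 hθα hVg 0 (by omega) c idx
  have hα12 : α ≤ 1 / 12 := hα24.trans (by norm_num)
  have hα4 : 4 * α ≤ 1 / 3 := by linarith
  have hℓ1 : (1 : ℝ) ≤ ((((F.P (i + 1)).d + 2) * (F.P (i + 1)).L : ℕ) : ℝ) := by
    exact_mod_cast Nat.one_le_iff_ne_zero.2 (Nat.mul_ne_zero (by omega) (F.P (i + 1)).L_pos.ne')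
  have hm0 : 0 ≤ ‖ζ‖ := norm_nonneg _
  have hXm : ‖(fun ℓ' : PBond (F.P (i + 1)) 0 => (⟨su2Coord (rev (ζ ℓ')), su2Coord_rev_mem_lie (ζ ℓ')⟩ : (specialUnitaryLogChart (Fin 2)).lie))‖ = ‖ζ‖ :=
    norm_coordField_eq ζ
  -- the sinc-fed field is no larger than `ζ`
  have hηle : ‖(fun ℓ' => Real.sinc ‖ζ ℓ'‖ • ζ ℓ' : PBond (F.P (i + 1)) 0 → EuclideanSpace ℝ (Fin 3))‖ ≤ ‖ζ‖ := by
    refine (pi_norm_le_iff_of_nonneg hm0).2 fun ℓ' => ?_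
    rw [norm_smul, Real.norm_eq_abs]
    exact (mul_le_of_le_one_left (norm_nonneg _) (Real.abs_sinc_le_one _)).trans (norm_le_pi_norm ζ ℓ')
  -- the derivative term is at most `216ℓ·‖ζ‖` (Q9a dictionary + (β-3)'s Cauchy sup bound)
  have hDη : ‖fderiv ℝ (fun (ζ : PBond (F.P (i + 1)) 0 → EuclideanSpace ℝ (Fin 3)) (B : PBond (F.P i) 0) =>
          imVec (su2Quat (descendTo F ℰp i (i + 1) (Nat.le_succ i) (fun ℓ => expPoint (ζ ℓ) * V ℓ) B *
            (descendTo F ℰp i (i + 1) (Nat.le_succ i) V B)⁻¹))) 0 (fun ℓ' => Real.sinc ‖ζ ℓ'‖ • ζ ℓ') b‖ ≤ 216 * ((((F.P (i + 1)).d + 2) * (F.P (i + 1)).L : ℕ) : ℝ) * ‖ζ‖ := by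
    rw [← norm_coord_eq, coord_qfderiv_one_apply (F := F) i hθ0 hθα hα24 hαδ hαL hVg _ b, Submodule.coe_norm]
    refine (norm_coe_fderiv_chartRead_le V (by norm_num) hρ hguard hα4 _ _).trans ?_
    rw [norm_coordField_eq]
    have h216 : (0 : ℝ) ≤ 216 * ((((F.P (i + 1)).d + 2) * (F.P (i + 1)).L : ℕ) : ℝ) := by positivity
    exact mul_le_mul_of_nonneg_left hηle h216
  by_cases hcase : 100 * (((((F.P (i + 1)).d + 2) * (F.P (i + 1)).L : ℕ) : ℝ) * (Real.exp ‖ζ‖ - 1)) ≤ 1 / 3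
  · -- WINDOW CASE
    have hem0 : 0 ≤ Real.exp ‖ζ‖ - 1 := by linarith [Real.add_one_le_exp ‖ζ‖]
    have hm300 : ‖ζ‖ ≤ 1 / 300 := by nlinarith [Real.add_one_le_exp ‖ζ‖]
    have hem2 : Real.exp ‖ζ‖ - 1 ≤ 2 * ‖ζ‖ := by
      have h3 := Real.abs_exp_sub_one_sub_id_le (x := ‖ζ‖) (by rw [abs_of_nonneg hm0]; linarith)
      have h4 : Real.exp ‖ζ‖ - 1 - ‖ζ‖ ≤ ‖ζ‖ ^ 2 := (le_abs_self _).trans h3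
      nlinarith
    -- the window at `σ₁ b` from (β-2)
    have hXexp : 100 * (((((F.P (i + 1)).d + 2) * (F.P (i + 1)).L : ℕ) : ℝ) * (Real.exp ‖(fun ℓ' : PBond (F.P (i + 1)) 0 =>
        (⟨su2Coord (rev (ζ ℓ')), su2Coord_rev_mem_lie (ζ ℓ')⟩ : (specialUnitaryLogChart (Fin 2)).lie))‖ - 1)) ≤ 1 / 3 := by rw [hXm]; exact hcase
    have hfield : (fun b' => (isChartRep_specialUnitaryGroup (n := Fin 2)).expChart ((fun ℓ' : PBond (F.P (i + 1)) 0 =>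
        (⟨su2Coord (rev (ζ ℓ')), su2Coord_rev_mem_lie (ζ ℓ')⟩ : (specialUnitaryLogChart (Fin 2)).lie)) b') * V b' : GaugeField (F.P (i + 1)) 0 (SU 2)) =
        fun ℓ => expPoint (ζ ℓ) * V ℓ := (piExpPoint_translate_eq V ζ).symm
    have hwin0 := norm_coe_relAvg_sub_one_le V
      (bondShift (F.sitesPerDir_eq (m := F.m) (K := i) (j := 0) (m' := F.m) (K' := i + 1) (j' := 1) (by omega)) b) hρ (hguard _) hα4 (by norm_num) _ hXexp
    rw [hfield] at hwin0
    have hwin : ‖((avgFun (expMeanLogSU (n := Fin 2)) (fun ℓ => expPoint (ζ ℓ) * V ℓ : GaugeField (F.P (i + 1)) 0 (SU 2))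
          (bondShift (F.sitesPerDir_eq (m := F.m) (K := i) (j := 0) (m' := F.m) (K' := i + 1) (j' := 1) (by omega)) b) *
        (avgFun (expMeanLogSU (n := Fin 2)) V
          (bondShift (F.sitesPerDir_eq (m := F.m) (K := i) (j := 0) (m' := F.m) (K' := i + 1) (j' := 1) (by omega)) b))⁻¹ : SU 2) :
          Matrix (Fin 2) (Fin 2) ℂ) - 1‖ < innerRadius (specialUnitaryLogChart (Fin 2)) :=
      lt_of_le_of_lt hwin0 (lt_of_lt_of_le (by nlinarith) hρ)
    -- Q9a's norm form and the three priced terms (all on the SAME explicit terms)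
    have hsplit := norm_qRead_one_sub_qfderiv_sinc_le (F := F) i hθ0 hθα hα24 hαδ hαL hVg ζ b hwin
    have hT1 := norm_chartRead_sub_fderiv_le_global_SU2 V hguard hα12
      (fun ℓ' : PBond (F.P (i + 1)) 0 => (⟨su2Coord (rev (ζ ℓ')), su2Coord_rev_mem_lie (ζ ℓ')⟩ : (specialUnitaryLogChart (Fin 2)).lie))
      (bondShift (F.sitesPerDir_eq (m := F.m) (K := i) (j := 0) (m' := F.m) (K' := i + 1) (j' := 1) (by omega)) b)
    rw [hXm] at hT1
    have hy := norm_coe_chartRead_le V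
      (bondShift (F.sitesPerDir_eq (m := F.m) (K := i) (j := 0) (m' := F.m) (K' := i + 1) (j' := 1) (by omega)) b) hρ (hguard _) hα4 (by norm_num) _ hXexp
    rw [hXm, ← Submodule.coe_norm] at hy
    have hT3 := norm_coe_fderiv_chartRead_le V (by norm_num) hρ hguard hα4
      (fun ℓ' : PBond (F.P (i + 1)) 0 => (Real.sinc ‖ζ ℓ'‖ - 1) • (⟨su2Coord (rev (ζ ℓ')), su2Coord_rev_mem_lie (ζ ℓ')⟩ : (specialUnitaryLogChart (Fin 2)).lie))
      (bondShift (F.sitesPerDir_eq (m := F.m) (K := i) (j := 0) (m' := F.m) (K' := i + 1) (j' := 1) (by omega)) b)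
    rw [← Submodule.coe_norm] at hT3
    -- the cubic input field: `‖W‖ ≤ ‖ζ‖²∕1800`
    have hW : ‖(fun ℓ' : PBond (F.P (i + 1)) 0 => (Real.sinc ‖ζ ℓ'‖ - 1) •
        (⟨su2Coord (rev (ζ ℓ')), su2Coord_rev_mem_lie (ζ ℓ')⟩ : (specialUnitaryLogChart (Fin 2)).lie))‖ ≤ ‖ζ‖ ^ 2 / 1800 := by
      refine (pi_norm_le_iff_of_nonneg (by positivity)).2 fun ℓ' => ?_
      have h1 := norm_sinc_sub_one_smul_coord_le (ζ ℓ')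
      have h2 : ‖ζ ℓ'‖ ≤ ‖ζ‖ := norm_le_pi_norm ζ ℓ'
      have h3 : ‖ζ ℓ'‖ ^ 3 ≤ ‖ζ‖ ^ 3 := pow_le_pow_left₀ (norm_nonneg _) h2 3
      have h4 : ‖ζ‖ ^ 3 ≤ ‖ζ‖ ^ 2 / 300 := by nlinarith [sq_nonneg ‖ζ‖]
      linarith
    exact hsplit.trans (window_arith hℓ1 hcase hem2 hT1 (norm_nonneg _) hy hT3 hW)
  · -- FAR CASE
    rw [not_le] at hcase
    have hMq : ‖imVec (su2Quat (descendTo F ℰp i (i + 1) (Nat.le_succ i) (fun ℓ => expPoint (ζ ℓ) * V ℓ) b *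
        (descendTo F ℰp i (i + 1) (Nat.le_succ i) V b)⁻¹))‖ ≤ 1 := norm_imVec_su2Quat_le_one _
    exact (norm_sub_le_of_le hMq hDη).trans (far_arith hℓ1 hm0 hcase)

end Global

/-! ## §3 Locality: the bracket reads `ζ` only on the two blocks of `σ₁ b` -/

section Local

/-- **LOCALITY OF THE ONE-STEP BRACKET**: replacing `ζ` by its two-block truncation `ζ^{(σ₁ b)}` changes neither `Mq^{one}(V) ζ b` (lit ✓`avgFun_local`) nor `DMq^{one}(V)(sinc∘ζ•ζ) b`
(✓`fderiv_chartRead_apply_local` through Q9a's derivative dictionary and injectivity of `coord`). [cite: Balaban1985Averaging, p.19 (locality of the averaging); Balaban1987RG1, (0.4) p.253] -/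
theorem qRead_one_sub_qfderiv_sinc_local (i : ℕ) (hj : 0 + 1 ≤ (F.P (i + 1)).m + (F.P (i + 1)).K) {θ : ℕ → ℝ} (hθ0 : ∀ i', 0 ≤ θ i') {α : ℝ}
    (hθα : ∀ i', i < i' → i' ≤ i + 1 → (((5 * F.L : ℕ) : ℝ) ^ 2 / 4) * θ i' ≤ α)
    (hα24 : α ≤ 1 / 24) (hαδ : α < deltaSU (Fin 2)) (hαL : 157 * α < ((F.L : ℝ) ^ 2)⁻¹)
    {V : GaugeField (F.P (i + 1)) 0 (SU 2)} (hVg : V ∈ histGood F ℰp θ (i + 1) i)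
    (ζ : PBond (F.P (i + 1)) 0 → EuclideanSpace ℝ (Fin 3)) (b : PBond (F.P i) 0) :
    imVec (su2Quat (descendTo F ℰp i (i + 1) (Nat.le_succ i) (fun ℓ => expPoint (ζ ℓ) * V ℓ) b *
          (descendTo F ℰp i (i + 1) (Nat.le_succ i) V b)⁻¹)) -
        fderiv ℝ (fun (ζ : PBond (F.P (i + 1)) 0 → EuclideanSpace ℝ (Fin 3)) (B : PBond (F.P i) 0) =>
          imVec (su2Quat (descendTo F ℰp i (i + 1) (Nat.le_succ i) (fun ℓ => expPoint (ζ ℓ) * V ℓ) B *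
            (descendTo F ℰp i (i + 1) (Nat.le_succ i) V B)⁻¹))) 0 (fun ℓ => Real.sinc ‖ζ ℓ‖ • ζ ℓ) b =
      imVec (su2Quat (descendTo F ℰp i (i + 1) (Nat.le_succ i)
            (fun ℓ => expPoint ((fun ℓ' : PBond (F.P (i + 1)) 0 =>
              if blockOf ℓ'.src = (bondShift (F.sitesPerDir_eq (m := F.m) (K := i) (j := 0) (m' := F.m) (K' := i + 1) (j' := 1) (by omega)) b).src ∨
                 blockOf ℓ'.src = (bondShift (F.sitesPerDir_eq (m := F.m) (K := i) (j := 0) (m' := F.m) (K' := i + 1) (j' := 1) (by omega)) b).tgt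
              then ζ ℓ' else 0) ℓ) * V ℓ) b *
          (descendTo F ℰp i (i + 1) (Nat.le_succ i) V b)⁻¹)) -
        fderiv ℝ (fun (ζ : PBond (F.P (i + 1)) 0 → EuclideanSpace ℝ (Fin 3)) (B : PBond (F.P i) 0) =>
          imVec (su2Quat (descendTo F ℰp i (i + 1) (Nat.le_succ i) (fun ℓ => expPoint (ζ ℓ) * V ℓ) B *
            (descendTo F ℰp i (i + 1) (Nat.le_succ i) V B)⁻¹))) 0
          (fun ℓ => Real.sinc ‖(fun ℓ' : PBond (F.P (i + 1)) 0 =>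
              if blockOf ℓ'.src = (bondShift (F.sitesPerDir_eq (m := F.m) (K := i) (j := 0) (m' := F.m) (K' := i + 1) (j' := 1) (by omega)) b).src ∨
                 blockOf ℓ'.src = (bondShift (F.sitesPerDir_eq (m := F.m) (K := i) (j := 0) (m' := F.m) (K' := i + 1) (j' := 1) (by omega)) b).tgt
              then ζ ℓ' else 0) ℓ‖ •
            (fun ℓ' : PBond (F.P (i + 1)) 0 =>
              if blockOf ℓ'.src = (bondShift (F.sitesPerDir_eq (m := F.m) (K := i) (j := 0) (m' := F.m) (K' := i + 1) (j' := 1) (by omega)) b).src ∨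
                 blockOf ℓ'.src = (bondShift (F.sitesPerDir_eq (m := F.m) (K := i) (j := 0) (m' := F.m) (K' := i + 1) (j' := 1) (by omega)) b).tgt
              then ζ ℓ' else 0) ℓ) b := by
  classical
  set σb := bondShift (F.sitesPerDir_eq (m := F.m) (K := i) (j := 0) (m' := F.m) (K' := i + 1) (j' := 1) (by omega)) b with hσb
  set ζ' : PBond (F.P (i + 1)) 0 → EuclideanSpace ℝ (Fin 3) := fun ℓ' => if blockOf ℓ'.src = σb.src ∨ blockOf ℓ'.src = σb.tgt then ζ ℓ' else 0 with hζ'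
  have hagree : ∀ ℓ' : PBond (F.P (i + 1)) 0, (blockOf ℓ'.src = σb.src ∨ blockOf ℓ'.src = σb.tgt) → ζ ℓ' = ζ' ℓ' := fun ℓ' h => by
    simp only [hζ', h, if_true]
  -- value half: avgFun locality
  have hval : avgFun (expMeanLogSU (n := Fin 2)) (fun ℓ => expPoint (ζ ℓ) * V ℓ : GaugeField (F.P (i + 1)) 0 (SU 2)) σb =
      avgFun (expMeanLogSU (n := Fin 2)) (fun ℓ => expPoint (ζ' ℓ) * V ℓ : GaugeField (F.P (i + 1)) 0 (SU 2)) σb :=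
    avgFun_local (expMeanLogSU (n := Fin 2)) hj _ _ σb (fun ℓ' h => by simp only [hagree ℓ' h])
  -- derivative half: through the dictionary
  have hguard : ∀ (c : PBond (F.P (i + 1)) (0 + 1)) (idx : Idx (F.P (i + 1))), dist1 (loopHol V c idx) ≤ α :=
    fun c idx => loopGuard_of_histGood (F := F) hθ0 hθα hVg 0 (by omega) c idx
  have hsmall : ∀ c : PBond (F.P (i + 1)) (0 + 1), Small (expMeanLogSU (n := Fin 2)) V c :=
    fun c idx => lt_of_le_of_lt (hguard c idx) hαδ
  have hagreeη : ∀ ℓ' : PBond (F.P (i + 1)) 0, (blockOf ℓ'.src = σb.src ∨ blockOf ℓ'.src = σb.tgt) →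
      (fun ℓ => (⟨su2Coord (rev ((fun ℓ => Real.sinc ‖ζ ℓ‖ • ζ ℓ) ℓ)), su2Coord_rev_mem_lie _⟩ : (specialUnitaryLogChart (Fin 2)).lie)) ℓ' =
      (fun ℓ => (⟨su2Coord (rev ((fun ℓ => Real.sinc ‖ζ' ℓ‖ • ζ' ℓ) ℓ)), su2Coord_rev_mem_lie _⟩ : (specialUnitaryLogChart (Fin 2)).lie)) ℓ' := fun ℓ' h => by
    simp only [hagree ℓ' h]
  have hder : fderiv ℝ (fun (ζ : PBond (F.P (i + 1)) 0 → EuclideanSpace ℝ (Fin 3)) (B : PBond (F.P i) 0) =>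
          imVec (su2Quat (descendTo F ℰp i (i + 1) (Nat.le_succ i) (fun ℓ => expPoint (ζ ℓ) * V ℓ) B *
            (descendTo F ℰp i (i + 1) (Nat.le_succ i) V B)⁻¹))) 0 (fun ℓ => Real.sinc ‖ζ ℓ‖ • ζ ℓ) b =
      fderiv ℝ (fun (ζ : PBond (F.P (i + 1)) 0 → EuclideanSpace ℝ (Fin 3)) (B : PBond (F.P i) 0) =>
          imVec (su2Quat (descendTo F ℰp i (i + 1) (Nat.le_succ i) (fun ℓ => expPoint (ζ ℓ) * V ℓ) B *
            (descendTo F ℰp i (i + 1) (Nat.le_succ i) V B)⁻¹))) 0 (fun ℓ => Real.sinc ‖ζ' ℓ‖ • ζ' ℓ) b := by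
    apply coord_injective'
    rw [coord_qfderiv_one_apply (F := F) i hθ0 hθα hα24 hαδ hαL hVg _ b, coord_qfderiv_one_apply (F := F) i hθ0 hθα hα24 hαδ hαL hVg _ b,
      fderiv_chartRead_apply_local (P := F.P (i + 1)) (N := 2) hj V hsmall σb hagreeη]
  rw [qRead_one_apply, qRead_one_apply, hval, hder]

set_option maxHeartbeats 400000 in
/-- ★★★ **THE ONE-STEP BRACKET, PRICED, RADIUS-FREE, LOCAL SUP**: under Q1's guard at `(i,i+1)` and the lattice guard `1 ≤ m + (i+1)`, for EVERY `ζ` and coarse `b`,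
`‖Mq^{one}(V) ζ b − DMq^{one}(V)(sinc∘ζ•ζ) b‖ ≤ 4551000·ℓ²·‖ζ^{(σ₁ b)}‖_∞²` with `ζ^{(c)} ℓ′ := if blockOf ℓ′.src ∈ {c.src, c.tgt} then ζ ℓ′ else 0` ((β-3)'s two-block currency).
[cite: Balaban1985Averaging, Prop. 3 (123) p.36, p.19; Balaban1987RG1, (0.4), (0.11) p.253; Balaban1985UV3, (7) p.257, p.260] -/
theorem norm_qRead_one_sub_qfderiv_sinc_le_sq_local (i : ℕ) (hj : 0 + 1 ≤ (F.P (i + 1)).m + (F.P (i + 1)).K) {θ : ℕ → ℝ} (hθ0 : ∀ i', 0 ≤ θ i') {α : ℝ}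
    (hθα : ∀ i', i < i' → i' ≤ i + 1 → (((5 * F.L : ℕ) : ℝ) ^ 2 / 4) * θ i' ≤ α)
    (hα24 : α ≤ 1 / 24) (hαδ : α < deltaSU (Fin 2)) (hαL : 157 * α < ((F.L : ℝ) ^ 2)⁻¹)
    {V : GaugeField (F.P (i + 1)) 0 (SU 2)} (hVg : V ∈ histGood F ℰp θ (i + 1) i)
    (ζ : PBond (F.P (i + 1)) 0 → EuclideanSpace ℝ (Fin 3)) (b : PBond (F.P i) 0) :
    ‖imVec (su2Quat (descendTo F ℰp i (i + 1) (Nat.le_succ i) (fun ℓ => expPoint (ζ ℓ) * V ℓ) b *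
          (descendTo F ℰp i (i + 1) (Nat.le_succ i) V b)⁻¹)) -
        fderiv ℝ (fun (ζ : PBond (F.P (i + 1)) 0 → EuclideanSpace ℝ (Fin 3)) (B : PBond (F.P i) 0) =>
          imVec (su2Quat (descendTo F ℰp i (i + 1) (Nat.le_succ i) (fun ℓ => expPoint (ζ ℓ) * V ℓ) B *
            (descendTo F ℰp i (i + 1) (Nat.le_succ i) V B)⁻¹))) 0 (fun ℓ => Real.sinc ‖ζ ℓ‖ • ζ ℓ) b‖ ≤
      4551000 * ((((F.P (i + 1)).d + 2) * (F.P (i + 1)).L : ℕ) : ℝ) ^ 2 *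
        ‖(fun ℓ' : PBond (F.P (i + 1)) 0 =>
            if blockOf ℓ'.src = (bondShift (F.sitesPerDir_eq (m := F.m) (K := i) (j := 0) (m' := F.m) (K' := i + 1) (j' := 1) (by omega)) b).src ∨
               blockOf ℓ'.src = (bondShift (F.sitesPerDir_eq (m := F.m) (K := i) (j := 0) (m' := F.m) (K' := i + 1) (j' := 1) (by omega)) b).tgt
            then ζ ℓ' else 0)‖ ^ 2 := by
  rw [qRead_one_sub_qfderiv_sinc_local (F := F) i hj hθ0 hθα hα24 hαδ hαL hVg ζ b]
  exact norm_qRead_one_sub_qfderiv_sinc_le_sq (F := F) i hθ0 hθα hα24 hαδ hαL hVg _ b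

end Local

/-! ## §4 The bracket of Q7's telescope for an arbitrary partner `W` -/

section Partner

set_option maxHeartbeats 400000 in
/-- ★★★ **THE ONE-STEP BRACKET OF Q7 FOR ANY PARTNER `W`, PRICED**: with the exact fine chords `ζ̃ ℓ := logVec (su2Quat (W ℓ·V ℓ⁻¹))` (so that the fine imVec chord is `sinc‖ζ̃‖•ζ̃`,
px17 ✓`chordField_eq_sinc_smul_logChord`, and the coarse imVec chord is `Mq^{one}(V) ζ̃`, Q7 ✓`qRead_apply_logVec_chord`), under Q1's guard at `(i,i+1)` and `1 ≤ m + (i+1)`: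
**`‖imVec (su2Quat (D_{i,i+1}W b·D_{i,i+1}V b⁻¹)) − DMq^{one}(V)(ℓ ↦ imVec (su2Quat (W ℓ·V ℓ⁻¹))) b‖ ≤ 4551000·ℓ²·‖ζ̃^{(σ₁ b)}‖_∞²`** — the per-bracket letter the two counts
((5a) smooth purse, (5b) ladder ∕ REL purse) consume. [cite: Balaban1985Averaging, Prop. 3 (123) p.36, (127)-(128) p.37, (148)-(149) p.40; Balaban1987RG1, (0.11) p.253] -/
theorem norm_oneStepBracket_le (i : ℕ) (hj : 0 + 1 ≤ (F.P (i + 1)).m + (F.P (i + 1)).K) {θ : ℕ → ℝ} (hθ0 : ∀ i', 0 ≤ θ i') {α : ℝ}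
    (hθα : ∀ i', i < i' → i' ≤ i + 1 → (((5 * F.L : ℕ) : ℝ) ^ 2 / 4) * θ i' ≤ α)
    (hα24 : α ≤ 1 / 24) (hαδ : α < deltaSU (Fin 2)) (hαL : 157 * α < ((F.L : ℝ) ^ 2)⁻¹)
    {V : GaugeField (F.P (i + 1)) 0 (SU 2)} (hVg : V ∈ histGood F ℰp θ (i + 1) i)
    (W : GaugeField (F.P (i + 1)) 0 (SU 2)) (b : PBond (F.P i) 0) :
    ‖imVec (su2Quat (descendTo F ℰp i (i + 1) (Nat.le_succ i) W b * (descendTo F ℰp i (i + 1) (Nat.le_succ i) V b)⁻¹)) -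
        fderiv ℝ (fun (ζ : PBond (F.P (i + 1)) 0 → EuclideanSpace ℝ (Fin 3)) (B : PBond (F.P i) 0) =>
          imVec (su2Quat (descendTo F ℰp i (i + 1) (Nat.le_succ i) (fun ℓ => expPoint (ζ ℓ) * V ℓ) B *
            (descendTo F ℰp i (i + 1) (Nat.le_succ i) V B)⁻¹))) 0 (fun ℓ => imVec (su2Quat (W ℓ * (V ℓ)⁻¹))) b‖ ≤
      4551000 * ((((F.P (i + 1)).d + 2) * (F.P (i + 1)).L : ℕ) : ℝ) ^ 2 *
        ‖(fun ℓ' : PBond (F.P (i + 1)) 0 =>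
            if blockOf ℓ'.src = (bondShift (F.sitesPerDir_eq (m := F.m) (K := i) (j := 0) (m' := F.m) (K' := i + 1) (j' := 1) (by omega)) b).src ∨
               blockOf ℓ'.src = (bondShift (F.sitesPerDir_eq (m := F.m) (K := i) (j := 0) (m' := F.m) (K' := i + 1) (j' := 1) (by omega)) b).tgt
            then logVec (su2Quat (W ℓ' * (V ℓ')⁻¹)) else 0)‖ ^ 2 := by
  have hval := congrFun (qRead_apply_logVec_chord (F := F) (Nat.le_succ i) W V) b
  simp only at hval
  rw [← hval, chordField_eq_sinc_smul_logChord W V]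
  exact norm_qRead_one_sub_qfderiv_sinc_le_sq_local (F := F) i hj hθ0 hθα hα24 hαδ hαL hVg _ b

end Partner

end Summit.QuantumFields.YangMills.Theorems.FluctuationComparisonRegPrIntLS2BetaQuaternionReadOneStepBracket

end
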